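import Mathlib
import Summits.AtomisticToContinuum.FouriersLaw.Theorems.EmbeddedDrudeMourreKineticConductivityFiniteFormDomain
import HarnessLib

/-!
# Every `2π`-periodic `C²` profile has finite Boltzmann form — `stub_formFiniteSmooth` (stub FIN) of line
`swap-odd-threshold-rigidity` (crux `EmbeddedDrudeMourre.MourreDissolution`, item stmt-AtomisticToContinuum-12594;
helper file, `--supports`)

Registered stub FIN of the checked skeleton of line `swap-odd-threshold-rigidity` (lead c8), in the
skeleton's stub namespace `Summit.AtomisticToContinuum.FouriersLaw.Theorems.MourreDissolution`,
registered in the shape `GL → BM → FIN`: the effective JACOBIAN FLOOR on the resonant set (GL,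
`c·|sin((k₃−k₁)/2) sin((k₂−k₃)/2)| ≤ |ω′(k₂) − ω′(k₄)|` at every real zero of `Ω`) and the BRACKET
MODULUS of a `C²` periodic profile (BM, `|f(k₁)+f(k₂)−f(k₃)−f(k₄)| ≤ K·|sin((k₃−k₁)/2) sin((k₂−k₃)/2)|`)
are taken as HYPOTHESES (they are other stubs of the skeleton; neither is restated or reproved here),
and the conclusion is `boltzmannForm ω₂ a b f < ⊤` for `ω₂ > 0`, ALL real couplings `a, b`, and every
`2π`-periodic `C²` profile `f` (`PhononBoltzmann.boltzmannForm` = ALS's resolved collision form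
`q_{ω₂,a,b}(f) = ¼ ∫∫ Σ_{k₂ resonant} w·[f]²`, `w = collisionWeight`, `[f] = f₁+f₂−f₃−f₄`).

Proof (the model is `KineticConductivityFinite.boltzmannForm_sin_lt_top`, whose special `sin` bracket
identity is replaced by GL + BM). Fix `ω₂ > 0`, `a`, `b`, `f`; take `c` from GL and `K` from BM.
* TERM BOUND (`formFiniteSmooth_term_le`): at a zero of `Ω` put `s = |sin((k₃−k₁)/2) sin((k₂−k₃)/2)|`,
  `0 ≤ s ≤ 1`. If `s = 0` the bracket vanishes (BM) and the term `w·[f]²` is `0`; otherwise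
  `J ≥ c s > 0` (GL), `[f]² ≤ K² s²` (BM), `Φ² ≤ (|a|+16|b|)²`
  (`FGRGap.Negative.OnsiteReduction.abs_sin_prod_le_one`), `(ω₁ω₂ω₃ω₄)² ≥ ω₂⁴`
  (`KineticConductivityFinite.le_dispersion_sq`), so
  `w·[f]² = als·Φ²(∏ω)⁻²J⁻¹[f]² ≤ als (|a|+16|b|)² ω₂⁻⁴ · K²s²/(c s) ≤ C₀ := als (|a|+16|b|)² ω₂⁻⁴ K²/c`
  (`formFiniteSmooth_term_alg`, ordered-field algebra).
* FIBRE BOUND (`formFiniteSmooth_finsum_le`): for `k₁ ≠ k₃` in the cell the resonant fibre is finite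
  (`PinnedChainResonantFinite.resonantSet_finite`) with at most twelve points
  (`KineticConductivityFinite.mem_candidates`), every term is `≤ C₀`, so the `finsum` is `≤ 12 C₀`;
  on the diagonal `k₁ = k₃` every bracket is `0` (`add_sub_cancel_left`).
* Two `setLIntegral_mono'` against the constant `12 C₀` on the cell `(−π, π]` (finite measure,
  `KineticConductivityFinite.volume_cell_lt_top`) give `q(f) ≤ ¼ · 12 C₀ · (2π)² < ∞`.
No cited facts are used; everything is elementary given GL and BM.
-/

noncomputable section

open Real Set MeasureTheory
open scoped ENNReal

namespace Summit.AtomisticToContinuum.FouriersLaw.Theorems.MourreDissolution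

open Literature.MathematicalPhysics.KineticTheory.PhononBoltzmann
open Summit.AtomisticToContinuum.FouriersLaw.Theorems.KineticConductivityFinite
open Summit.AtomisticToContinuum.FouriersLaw.Theorems.FGRGap.Negative.OnsiteReduction

/-! ### 1. Pointwise inputs: vertex, band product, half-angle sines -/

/-- `|Φ_{a,b}| ≤ |a| + 16|b|` for ALL real couplings (`|∏ sin(kⱼ/2)| ≤ 1`). [folklore] -/
theorem formFiniteSmooth_abs_vertex_le (a b k₁ k₂ k₃ : ℝ) :
    |vertex a b k₁ k₂ k₃| ≤ |a| + 16 * |b| := by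
  have h := abs_sin_prod_le_one k₁ k₂ k₃
  unfold vertex
  calc |a + 16 * b * (Real.sin (k₁ / 2) * Real.sin (k₂ / 2) * Real.sin (k₃ / 2) *
          Real.sin ((k₁ + k₂ - k₃) / 2))|
      ≤ |a| + |16 * b * (Real.sin (k₁ / 2) * Real.sin (k₂ / 2) * Real.sin (k₃ / 2) *
          Real.sin ((k₁ + k₂ - k₃) / 2))| := abs_add_le _ _
    _ = |a| + 16 * |b| * |Real.sin (k₁ / 2) * Real.sin (k₂ / 2) * Real.sin (k₃ / 2) *
          Real.sin ((k₁ + k₂ - k₃) / 2)| := by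
        rw [abs_mul, abs_mul, abs_of_pos (by norm_num : (0 : ℝ) < 16)]
    _ ≤ |a| + 16 * |b| * 1 := by gcongr
    _ = |a| + 16 * |b| := by ring

/-- `Φ_{a,b}² ≤ (|a| + 16|b|)²` for all real couplings. [folklore] -/
theorem formFiniteSmooth_vertex_sq_le (a b k₁ k₂ k₃ : ℝ) :
    vertex a b k₁ k₂ k₃ ^ 2 ≤ (|a| + 16 * |b|) ^ 2 := by
  rw [← sq_abs (vertex a b k₁ k₂ k₃)]
  exact pow_le_pow_left₀ (abs_nonneg _) (formFiniteSmooth_abs_vertex_le a b k₁ k₂ k₃) 2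

/-- `ω₂⁴ ≤ (ω(k₁)ω(k₂)ω(k₃)ω(k₄))²`, `k₄ = k₁ + k₂ − k₃` (`ω₂ ≤ ω(k)²` in every leg). [folklore] -/
theorem formFiniteSmooth_pow_four_le_prod_sq {ω₂ : ℝ} (hω : 0 < ω₂) (k₁ k₂ k₃ : ℝ) :
    ω₂ ^ 4 ≤ (dispersion ω₂ k₁ * dispersion ω₂ k₂ * dispersion ω₂ k₃ *
      dispersion ω₂ (k₁ + k₂ - k₃)) ^ 2 := by
  have h1 := le_dispersion_sq hω.le k₁
  have h2 := le_dispersion_sq hω.le k₂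
  have h3 := le_dispersion_sq hω.le k₃
  have h4 := le_dispersion_sq hω.le (k₁ + k₂ - k₃)
  calc ω₂ ^ 4 = ω₂ * ω₂ * ω₂ * ω₂ := by ring
    _ ≤ dispersion ω₂ k₁ ^ 2 * dispersion ω₂ k₂ ^ 2 * dispersion ω₂ k₃ ^ 2 *
          dispersion ω₂ (k₁ + k₂ - k₃) ^ 2 := by gcongr
    _ = _ := by ring

/-- `|sin((k₃−k₁)/2) sin((k₂−k₃)/2)| ≤ 1`. [folklore] -/
theorem formFiniteSmooth_abs_sin_half_prod_le_one (k₁ k₂ k₃ : ℝ) :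
    |Real.sin ((k₃ - k₁) / 2) * Real.sin ((k₂ - k₃) / 2)| ≤ 1 := by
  rw [abs_mul]
  exact mul_le_one₀ (Real.abs_sin_le_one _) (abs_nonneg _) (Real.abs_sin_le_one _)

/-! ### 2. The term bound -/

/-- Algebraic core of the term bound: if `0 ≤ X ≤ A`, `|B| ≤ K s`, `c s ≤ J` with `c > 0`,
`0 ≤ s ≤ 1`, then `X/J · B² ≤ A K²/c` (for `s = 0` the bracket `B` vanishes; for `s > 0`,
`X/J · B² ≤ X/(cs) · K²s² = X K² s/c ≤ A K²/c`). [folklore] -/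
theorem formFiniteSmooth_term_alg {X A J B K c s : ℝ} (hX0 : 0 ≤ X) (hXA : X ≤ A) (hc : 0 < c)
    (hs0 : 0 ≤ s) (hs1 : s ≤ 1) (hB : |B| ≤ K * s) (hJ : c * s ≤ J) :
    X / J * B ^ 2 ≤ A * K ^ 2 / c := by
  have hA : 0 ≤ A := hX0.trans hXA
  rcases hs0.eq_or_lt with hs | hs
  · have hB0 : B = 0 := by
      rw [← hs, mul_zero] at hB
      exact abs_nonpos_iff.1 hB
    rw [hB0]
    calc X / J * (0 : ℝ) ^ 2 = 0 := by ring
      _ ≤ A * K ^ 2 / c := by positivity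
  · have hcs : 0 < c * s := mul_pos hc hs
    calc X / J * B ^ 2 ≤ X / (c * s) * (K * s) ^ 2 := by
          refine mul_le_mul (div_le_div_of_nonneg_left hX0 hcs hJ) ?_ (sq_nonneg _)
            (div_nonneg hX0 hcs.le)
          rw [← sq_abs B]
          exact pow_le_pow_left₀ (abs_nonneg B) hB 2
      _ = X * K ^ 2 * s / c := by
          rw [div_mul_eq_mul_div, div_eq_div_iff hcs.ne' hc.ne']
          ring
      _ ≤ A * K ^ 2 * 1 / c := by gcongr
      _ = A * K ^ 2 / c := by ring

/-- **Term bound.** Given a Jacobian floor `c·s ≤ J` on the zeros of `Ω` (`c > 0`) and a bracket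
modulus `|[f]| ≤ K·s`, `s = |sin((k₃−k₁)/2) sin((k₂−k₃)/2)|`, every term of ALS's resolved form at a
zero of `Ω` obeys `w_{a,b}(k₁,k₂,k₃)·[f]² ≤ alsPrefactor (|a|+16|b|)² ω₂⁻⁴ K²/c`
(`ω₂ > 0`; `Φ² ≤ (|a|+16|b|)²`, `(∏ω)² ≥ ω₂⁴`, `s ≤ 1`). [folklore] -/
theorem formFiniteSmooth_term_le {ω₂ a b c K : ℝ} {f : ℝ → ℝ} (hω : 0 < ω₂) (hc : 0 < c)
    (hJ : ∀ k₁ k₂ k₃ : ℝ, resonanceFn ω₂ k₁ k₂ k₃ = 0 →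
      c * |Real.sin ((k₃ - k₁) / 2) * Real.sin ((k₂ - k₃) / 2)| ≤ resonanceJacobian ω₂ k₁ k₂ k₃)
    (hB : ∀ k₁ k₂ k₃ : ℝ, |f k₁ + f k₂ - f k₃ - f (k₁ + k₂ - k₃)| ≤
      K * |Real.sin ((k₃ - k₁) / 2) * Real.sin ((k₂ - k₃) / 2)|)
    {k₁ k₂ k₃ : ℝ} (hres : resonanceFn ω₂ k₁ k₂ k₃ = 0) :
    collisionWeight ω₂ a b k₁ k₂ k₃ * (f k₁ + f k₂ - f k₃ - f (k₁ + k₂ - k₃)) ^ 2 ≤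
      alsPrefactor * (|a| + 16 * |b|) ^ 2 / ω₂ ^ 4 * K ^ 2 / c := by
  have ha := alsPrefactor_pos
  have hP := formFiniteSmooth_pow_four_le_prod_sq hω k₁ k₂ k₃
  have hω4 : 0 < ω₂ ^ 4 := by positivity
  unfold collisionWeight
  refine formFiniteSmooth_term_alg ?_ ?_ hc (abs_nonneg _)
    (formFiniteSmooth_abs_sin_half_prod_le_one k₁ k₂ k₃) (hB k₁ k₂ k₃) (hJ k₁ k₂ k₃ hres)
  · positivity
  · exact div_le_div₀ (by positivity)
      (mul_le_mul_of_nonneg_left (formFiniteSmooth_vertex_sq_le a b k₁ k₂ k₃) ha.le) hω4 hP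

/-! ### 3. The fibre bound and finiteness of the form -/

/-- **Fibre bound.** Under the same two hypotheses, for `k₁, k₃` in the cell `(−π, π]` the finite
sum over the resonant fibre of the terms `w_{a,b}·[f]²` is at most
`12 · alsPrefactor (|a|+16|b|)² ω₂⁻⁴ K²/c`: off the diagonal the fibre has at most twelve points
(`KineticConductivityFinite.mem_candidates`, `PinnedChainResonantFinite.resonantSet_finite`) and each
term obeys `formFiniteSmooth_term_le`; on the diagonal `k₁ = k₃` every bracket vanishes. [folklore] -/
theorem formFiniteSmooth_finsum_le {ω₂ a b c K : ℝ} {f : ℝ → ℝ} (hω : 0 < ω₂) (hc : 0 < c)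
    (hJ : ∀ k₁ k₂ k₃ : ℝ, resonanceFn ω₂ k₁ k₂ k₃ = 0 →
      c * |Real.sin ((k₃ - k₁) / 2) * Real.sin ((k₂ - k₃) / 2)| ≤ resonanceJacobian ω₂ k₁ k₂ k₃)
    (hB : ∀ k₁ k₂ k₃ : ℝ, |f k₁ + f k₂ - f k₃ - f (k₁ + k₂ - k₃)| ≤
      K * |Real.sin ((k₃ - k₁) / 2) * Real.sin ((k₂ - k₃) / 2)|)
    {k₁ k₃ : ℝ} (hk₁ : k₁ ∈ Ioc (-π) π) (hk₃ : k₃ ∈ Ioc (-π) π) :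
    ∑ᶠ k₂ ∈ resonantSet ω₂ k₁ k₃,
        collisionWeight ω₂ a b k₁ k₂ k₃ * (f k₁ + f k₂ - f k₃ - f (k₁ + k₂ - k₃)) ^ 2 ≤
      12 * (alsPrefactor * (|a| + 16 * |b|) ^ 2 / ω₂ ^ 4 * K ^ 2 / c) := by
  have ha := alsPrefactor_pos
  have hC : 0 ≤ alsPrefactor * (|a| + 16 * |b|) ^ 2 / ω₂ ^ 4 * K ^ 2 / c := by positivity
  by_cases hne : k₁ = k₃
  · subst hne
    have h0 : ∀ k₂ : ℝ, collisionWeight ω₂ a b k₁ k₂ k₁ *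
        (f k₁ + f k₂ - f k₁ - f (k₁ + k₂ - k₁)) ^ 2 = 0 := by
      intro k₂
      have e : k₁ + k₂ - k₁ = k₂ := by ring
      rw [e]
      ring
    simp_rw [h0]
    simp only [finsum_zero]
    positivity
  have hfin := resonantSet_finite hω hk₁ hk₃ hne
  rw [finsum_mem_eq_finite_toFinset_sum _ hfin]
  -- the twelve candidates (as in `KineticConductivityFinite.finsum_term_le`)
  set T₂ : Finset ℝ := {Real.cos ((k₁ + k₃) / 2),
    Real.cos ((k₁ - k₃) / 2) * (dispersion ω₂ k₁ - dispersion ω₂ k₃) ^ 2 /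
      (2 * Real.sin ((k₁ - k₃) / 2) ^ 2) - Real.cos ((k₁ + k₃) / 2)} with hT₂
  set S : Finset ℝ := ((T₂ ×ˢ ({1, -1} : Finset ℝ)) ×ˢ ({-1, 0, 1} : Finset ℝ)).image
    (fun q : (ℝ × ℝ) × ℝ => q.1.2 * Real.arccos q.1.1 - (k₁ - k₃) / 2 + 2 * q.2 * π) with hS
  have hsub : hfin.toFinset ⊆ S := by
    rw [Set.Finite.toFinset_subset]
    intro k₂ hk₂
    obtain ⟨t, ht, σ, hσ, n, hn, hk⟩ := mem_candidates hω hk₁ hk₃ hne hk₂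
    rw [hS, Finset.coe_image]
    exact ⟨((t, σ), n), by simp only [Finset.coe_product]; exact ⟨⟨ht, hσ⟩, hn⟩, hk.symm⟩
  have hcard : (hfin.toFinset).card ≤ 12 := by
    refine (Finset.card_le_card hsub).trans (Finset.card_image_le.trans ?_)
    rw [Finset.card_product, Finset.card_product]
    have h1 : T₂.card ≤ 2 := Finset.card_le_two
    have h2 : ({1, -1} : Finset ℝ).card ≤ 2 := Finset.card_le_two
    have h3 : ({-1, 0, 1} : Finset ℝ).card ≤ 3 := Finset.card_le_three
    calc T₂.card * ({1, -1} : Finset ℝ).card * ({-1, 0, 1} : Finset ℝ).card ≤ 2 * 2 * 3 := by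
          gcongr
      _ = 12 := by norm_num
  calc ∑ k₂ ∈ hfin.toFinset, collisionWeight ω₂ a b k₁ k₂ k₃ *
          (f k₁ + f k₂ - f k₃ - f (k₁ + k₂ - k₃)) ^ 2
      ≤ ∑ k₂ ∈ hfin.toFinset, alsPrefactor * (|a| + 16 * |b|) ^ 2 / ω₂ ^ 4 * K ^ 2 / c :=
        Finset.sum_le_sum fun k₂ hk₂ =>
          formFiniteSmooth_term_le hω hc hJ hB (hfin.mem_toFinset.1 hk₂).2
    _ = (hfin.toFinset).card * (alsPrefactor * (|a| + 16 * |b|) ^ 2 / ω₂ ^ 4 * K ^ 2 / c) := by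
        rw [Finset.sum_const, nsmul_eq_mul]
    _ ≤ 12 * (alsPrefactor * (|a| + 16 * |b|) ^ 2 / ω₂ ^ 4 * K ^ 2 / c) :=
        mul_le_mul_of_nonneg_right (by exact_mod_cast hcard) hC

/-- **STUB FIN — `stub_formFiniteSmooth`** (registered shape `GL → BM → FIN` of the skeleton of line
`swap-odd-threshold-rigidity`, crux `EmbeddedDrudeMourre.MourreDissolution`): GIVEN an effective
Jacobian floor on the resonant set (GL: for every `ω₂ > 0` some `c > 0` with
`c·|sin((k₃−k₁)/2) sin((k₂−k₃)/2)| ≤ resonanceJacobian ω₂ k₁ k₂ k₃` at every zero of `resonanceFn ω₂`)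
and a bracket modulus for `2π`-periodic `C²` profiles (BM: some `K ≥ 0` with
`|f(k₁)+f(k₂)−f(k₃)−f(k₁+k₂−k₃)| ≤ K·|sin((k₃−k₁)/2) sin((k₂−k₃)/2)|`), EVERY `2π`-periodic `C²`
profile is in the form domain of ALS's linearised collision operator of the pinned chain:
`boltzmannForm ω₂ a b f < ⊤` for `ω₂ > 0` and all real couplings `a, b`. The tree had this only for
`f = sin` (`KineticConductivityFinite.boltzmannForm_sin_lt_top`); the proof is that one with the term
bound `formFiniteSmooth_term_le` in place of the special `sin` bracket identity ("the singular
denominator in (4.11) is cancelled exactly", Aoki–Lukkarinen–Spohn 2006, §4 after (4.16)). [folklore] -/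
theorem stub_formFiniteSmooth :
    (∀ ω₂ : ℝ, 0 < ω₂ → ∃ c : ℝ, 0 < c ∧ ∀ k₁ k₂ k₃ : ℝ, resonanceFn ω₂ k₁ k₂ k₃ = 0 →
      c * |Real.sin ((k₃ - k₁) / 2) * Real.sin ((k₂ - k₃) / 2)| ≤ resonanceJacobian ω₂ k₁ k₂ k₃) →
    (∀ f : ℝ → ℝ, Function.Periodic f (2 * Real.pi) → ContDiff ℝ 2 f → ∃ K : ℝ, 0 ≤ K ∧
      ∀ k₁ k₂ k₃ : ℝ, |f k₁ + f k₂ - f k₃ - f (k₁ + k₂ - k₃)| ≤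
        K * |Real.sin ((k₃ - k₁) / 2) * Real.sin ((k₂ - k₃) / 2)|) →
    ∀ ω₂ a b : ℝ, 0 < ω₂ → ∀ f : ℝ → ℝ, Function.Periodic f (2 * Real.pi) → ContDiff ℝ 2 f →
      boltzmannForm ω₂ a b f < ⊤ := by
  intro hGL hBM ω₂ a b hω f hf hf2
  obtain ⟨c, hc, hJ⟩ := hGL ω₂ hω
  obtain ⟨K, -, hB⟩ := hBM f hf hf2
  unfold boltzmannForm
  set C : ℝ := 12 * (alsPrefactor * (|a| + 16 * |b|) ^ 2 / ω₂ ^ 4 * K ^ 2 / c) with hCdef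
  have hinner : ∀ k₁ ∈ Ioc (-π) π,
      (∫⁻ k₃ in Ioc (-π) π, ENNReal.ofReal (∑ᶠ k₂ ∈ resonantSet ω₂ k₁ k₃,
        collisionWeight ω₂ a b k₁ k₂ k₃ * (f k₁ + f k₂ - f k₃ - f (k₁ + k₂ - k₃)) ^ 2)) ≤
        ENNReal.ofReal C * volume (Ioc (-π) π) := by
    intro k₁ hk₁
    calc _ ≤ ∫⁻ _ in Ioc (-π) π, ENNReal.ofReal C :=
          setLIntegral_mono' measurableSet_Ioc fun k₃ hk₃ =>
            ENNReal.ofReal_le_ofReal (formFiniteSmooth_finsum_le hω hc hJ hB hk₁ hk₃)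
      _ = ENNReal.ofReal C * volume (Ioc (-π) π) := setLIntegral_const _ _
  have houter : (∫⁻ k₁ in Ioc (-π) π, ∫⁻ k₃ in Ioc (-π) π,
      ENNReal.ofReal (∑ᶠ k₂ ∈ resonantSet ω₂ k₁ k₃, collisionWeight ω₂ a b k₁ k₂ k₃ *
        (f k₁ + f k₂ - f k₃ - f (k₁ + k₂ - k₃)) ^ 2)) ≤
      ENNReal.ofReal C * volume (Ioc (-π) π) * volume (Ioc (-π) π) := by
    calc _ ≤ ∫⁻ _ in Ioc (-π) π, ENNReal.ofReal C * volume (Ioc (-π) π) :=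
          setLIntegral_mono' measurableSet_Ioc fun k₁ hk₁ => hinner k₁ hk₁
      _ = _ := setLIntegral_const _ _
  refine ENNReal.mul_lt_top ENNReal.ofReal_lt_top (lt_of_le_of_lt houter ?_)
  exact ENNReal.mul_lt_top (ENNReal.mul_lt_top ENNReal.ofReal_lt_top volume_cell_lt_top)
    volume_cell_lt_top

end Summit.AtomisticToContinuum.FouriersLaw.Theorems.MourreDissolution

end
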